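import Summits.ResolutionOfSingularities.ResolutionOfSingularities.Theorems.FrobeniusLadderFInjectiveMacaulayficationFedderSingletonSupport
import Summits.ResolutionOfSingularities.ResolutionOfSingularities.Theorems.FrobeniusLadderFInjectiveMacaulayficationHFedderCertificates
import Summits.ResolutionOfSingularities.ResolutionOfSingularities.Theorems.FrobeniusLadderFInjectiveMacaulayficationThreefoldG3Prime
import Mathlib.RingTheory.MvPolynomial.WeightedHomogeneous
import Mathlib.Tactic.Ring
import Mathlib.Tactic.IntervalCases
import HarnessLib

/-!
# The CI Fedder `x`-witness for `T₁₁⁺ = V(Φ − y² − x³, z² + Φ³ + x¹¹ + w⁷) ⊂ 𝔸⁵` in characteristic `7`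
# (crux `FInjectiveMacaulayfication`, K-T4 Lean half, piece (v) `hoff`, first half)

Support file for crux stmt-ResolutionOfSingularities-15315 (`FrobeniusLadder.FInjectiveMacaulayfication`), chain w45a,
seat res-L1-w45a-stub-4 (res-L1-w45a-plan-1 R11.4 «stub-4 → K-T4 Lean half with stub-6»; object (v) of res-D-pv-018 AS
stub-6, 06:59:22Z). [OURS · L1 W4.5a] — NOT a statement of the manuscript [claim: Hironaka2017]; AI-written, weaker than
expert review.

THE SPECIMEN (idea-1's key re-embedding of `T₁₁ = z² + (y²+x³)³ + x¹¹ + w⁷`, κ = 1): `F₁ = Φ − y² − x³`, `F₂ = z² + Φ³ + x¹¹ + w⁷`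
in `k[x,y,z,w,Φ] = MvPolynomial (Fin 5) k` (this order), `p = 7`. The `hoff` input of the c.i.-CN engine
`CIConeFiModelSmooth.ciConeFiModelRel_of_smoothFaceCertificates` (p507224) asks for the crux clause at every closed point of
`X = V(F₁,F₂)` with `x ≠ 0` or `Φ ≠ 0`. This file does the points with `x ≠ 0` — which include the NON-REGULAR far points
(`x² = 3`, tri-1 F15) — by Fedder's criterion for the complete intersection with the element `(F₁F₂)⁶` [Fedder1983, Prop. 2.1]:
the monomial `γ₀ = x²⁰y⁶z⁶Φ⁶` of `(F₁F₂)⁶` (coefficient `1200 ≡ 3`) is ALONE in its residue class mod `7`, so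
`FedderSingletonSupport.fedder_of_singleton_support` applies at every `K`-point `b` with `b_x ≠ 0`. `(F₁F₂)⁶` is NOT weighted
homogeneous, but for `ρ = (42,77,231,66,154)` it is the sum of SEVEN homogeneous pieces (`F₂` has weight `462`, `Φ − y²` weight
`154`, `x³` weight `126`): its support has weights `3528 + 28c`, `c ≤ 6` (§2), and the class of `γ₀` meets these seven weights
only in `γ₀` (§3, `42t₀+77t₁+231t₂+66t₃+154t₄ = 72 + 4c` forces `c = 3`, `t = (2,0,0,0,0)`). The coefficient (§4) is read WITHOUT
expanding the 2352-term polynomial: three binomial peelings `F₂ = (z²+Φ³+x¹¹) + w⁷` (`w⁷`-multiples die), `(z² + H)⁶`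
(only `z⁶`), `((Φ−x³) − y²)⁶` (only `y⁶`), each closed by `ring` on folded expressions, leave
`coeff_{x²⁰Φ⁶} ((Φ−x³)³(Φ³+x¹¹)³) = −3` (16 terms).

* §1 `coeff_X_pow_mul_of_notMem_vars` — `coeff d (X_s^m · q) = [m = d_s]·coeff (d − m e_s) q` for `q` free of `X_s`;
* §2 `weight_of_mem_support` — the seven weights; §3 `arith_t`, `eq_gamma0_of_weight` — the singleton class;
* §4 the peelings and `coeff_gamma0 = 1200`; §5 `t11Plus_fedder_x`.

No definitions, no named facts. [cite: Fedder1983, Prop. 1.7 and Prop. 2.1 (criterion); the computation is OURS,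
cross-checked by compute/kt4/witness_t11.py of this seat]
-/

-- single-problem summit: the doubled namespace component is forced
set_option linter.dupNamespace false

noncomputable section

namespace Summit.ResolutionOfSingularities.ResolutionOfSingularities.Theorems.FInjectiveMacaulayfication.T11PlusFedderData

open MvPolynomial
open Summit.ResolutionOfSingularities.ResolutionOfSingularities.Theorems.FInjectiveMacaulayfication
open FedderSingletonSupport HFedderCertificates ThreefoldG3Prime

/-! ## §1 Coefficients of `X_s^m · q` for `q` free of `X_s` -/

/-- A coefficient whose exponent involves a variable absent from `q` vanishes. [folklore] -/
theorem coeff_eq_zero_of_notMem_vars {σ R : Type*} [CommSemiring R] {q : MvPolynomial σ R} {s : σ} (hs : s ∉ q.vars)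
    {e : σ →₀ ℕ} (he : e s ≠ 0) : coeff e q = 0 := by
  classical
  by_contra h
  exact hs ((mem_vars_iff_mem_support s).mpr ⟨e, mem_support_iff.mpr h, Finsupp.mem_support_iff.mpr he⟩)

/-- `coeff d (X_s^m · q) = coeff (d − m·e_s) q` if `m = d_s` and `0` otherwise, for `q` free of `X_s`. [folklore] -/
theorem coeff_X_pow_mul_of_notMem_vars {σ R : Type*} [CommSemiring R] [DecidableEq σ] (d : σ →₀ ℕ) (s : σ) (m : ℕ)
    (q : MvPolynomial σ R) (hq : s ∉ q.vars) :
    coeff d (X s ^ m * q) = if m = d s then coeff (d - Finsupp.single s m) q else 0 := by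
  rw [X_pow_eq_monomial, coeff_monomial_mul']
  by_cases h : m = d s
  · rw [if_pos h, if_pos (Finsupp.single_le_iff.mpr h.le), one_mul]
  · rw [if_neg h]
    split_ifs with hle
    · rw [one_mul]
      refine coeff_eq_zero_of_notMem_vars hq ?_
      have hle' := Finsupp.single_le_iff.mp hle
      rw [Finsupp.tsub_apply, Finsupp.single_eq_same]
      omega
    · rfl

/-- Subtraction does not introduce variables. [folklore] -/
theorem notMem_vars_sub {σ R : Type*} [CommRing R] [DecidableEq σ] {i : σ} {p q : MvPolynomial σ R} (hp : i ∉ p.vars)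
    (hq : i ∉ q.vars) : i ∉ (p - q).vars := by
  rw [sub_eq_add_neg]
  exact notMem_vars_add hp (by rwa [vars_neg])

/-- Numerals have no variables. [folklore] -/
theorem notMem_vars_ofNat {σ R : Type*} [CommRing R] {i : σ} (n : ℕ) [n.AtLeastTwo] :
    i ∉ (OfNat.ofNat n : MvPolynomial σ R).vars := by
  rw [← map_ofNat (C : R →+* MvPolynomial σ R) n, vars_C]
  exact Finset.notMem_empty _

/-! ## §2 The seven weighted pieces of `(F₁F₂)⁶` -/

section Weights

variable {k : Type} [Field k]

/-- The weight of an exponent vector for `ρ = (42,77,231,66,154)`. [folklore] -/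
theorem weight_five (γ : Fin 5 →₀ ℕ) :
    Finsupp.weight (![42, 77, 231, 66, 154] : Fin 5 → ℕ) γ = 42 * γ 0 + 77 * γ 1 + 231 * γ 2 + 66 * γ 3 + 154 * γ 4 := by
  rw [Finsupp.weight_apply, Finsupp.sum_fintype _ _ (fun i => by simp)]
  simp only [Fin.sum_univ_five, smul_eq_mul, Matrix.cons_val_zero, Matrix.cons_val_one, Matrix.cons_val]
  ring

/-- `Φ − y²` is `ρ`-homogeneous of weight `154`, `−x³` of weight `126`, `F₂` of weight `462`. [folklore] -/
theorem isWeightedHomogeneous_pieces (F₂ : MvPolynomial (Fin 5) k) (hF₂ : F₂ = X 2 ^ 2 + X 4 ^ 3 + X 0 ^ 11 + X 3 ^ 7) :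
    IsWeightedHomogeneous (![42, 77, 231, 66, 154] : Fin 5 → ℕ) (X 4 - X 1 ^ 2 : MvPolynomial (Fin 5) k) 154 ∧
    IsWeightedHomogeneous (![42, 77, 231, 66, 154] : Fin 5 → ℕ) (-(X 0 ^ 3) : MvPolynomial (Fin 5) k) 126 ∧
    IsWeightedHomogeneous (![42, 77, 231, 66, 154] : Fin 5 → ℕ) F₂ 462 := by
  have h4 := isWeightedHomogeneous_X k (![42, 77, 231, 66, 154] : Fin 5 → ℕ) 4
  have h1 := (isWeightedHomogeneous_X k (![42, 77, 231, 66, 154] : Fin 5 → ℕ) 1).pow 2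
  have h0 := (isWeightedHomogeneous_X k (![42, 77, 231, 66, 154] : Fin 5 → ℕ) 0).pow 3
  have h2 := (isWeightedHomogeneous_X k (![42, 77, 231, 66, 154] : Fin 5 → ℕ) 2).pow 2
  have h43 := (isWeightedHomogeneous_X k (![42, 77, 231, 66, 154] : Fin 5 → ℕ) 4).pow 3
  have h011 := (isWeightedHomogeneous_X k (![42, 77, 231, 66, 154] : Fin 5 → ℕ) 0).pow 11
  have h37 := (isWeightedHomogeneous_X k (![42, 77, 231, 66, 154] : Fin 5 → ℕ) 3).pow 7
  norm_num at h4 h1 h0 h2 h43 h011 h37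
  refine ⟨?_, ?_, ?_⟩
  · have hs := Submodule.sub_mem _ ((mem_weightedHomogeneousSubmodule _ _ _ _).mpr h4)
      ((mem_weightedHomogeneousSubmodule _ _ _ _).mpr h1)
    exact (mem_weightedHomogeneousSubmodule _ _ _ _).mp hs
  · have hs := Submodule.neg_mem _ ((mem_weightedHomogeneousSubmodule _ _ _ _).mpr h0)
    exact (mem_weightedHomogeneousSubmodule _ _ _ _).mp hs
  · rw [hF₂]
    exact ((h2.add h43).add h011).add h37

/-- **The seven pieces**: a monomial of `(F₁F₂)⁶` has `ρ`-weight `3528 + 28c` for some `c ≤ 6` (`c` = the number of factors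
`Φ − y²` chosen in `((Φ−y²) + (−x³))⁶`). [folklore] -/
theorem weight_of_mem_support (F₁ F₂ : MvPolynomial (Fin 5) k)
    (hF₁ : F₁ = X 4 - X 1 ^ 2 - X 0 ^ 3) (hF₂ : F₂ = X 2 ^ 2 + X 4 ^ 3 + X 0 ^ 11 + X 3 ^ 7)
    (γ : Fin 5 →₀ ℕ) (hγ : coeff γ ((F₁ * F₂) ^ 6) ≠ 0) :
    ∃ c : ℕ, c ≤ 6 ∧ Finsupp.weight (![42, 77, 231, 66, 154] : Fin 5 → ℕ) γ = 3528 + 28 * c := by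
  obtain ⟨hA, hB, hF⟩ := isWeightedHomogeneous_pieces (k := k) F₂ hF₂
  have hsplit : (F₁ * F₂) ^ 6 = ∑ c ∈ Finset.range (6 + 1),
      (X 4 - X 1 ^ 2 : MvPolynomial (Fin 5) k) ^ c * (-(X 0 ^ 3)) ^ (6 - c) * (Nat.choose 6 c : MvPolynomial (Fin 5) k) *
        F₂ ^ 6 := by
    rw [mul_pow, ← Finset.sum_mul, ← add_pow, hF₁, sub_eq_add_neg (X 4 - X 1 ^ 2)]
  rw [hsplit, coeff_sum] at hγ
  obtain ⟨c, hc, hcoeff⟩ := Finset.exists_ne_zero_of_sum_ne_zero hγ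
  have hhom : IsWeightedHomogeneous (![42, 77, 231, 66, 154] : Fin 5 → ℕ)
      ((X 4 - X 1 ^ 2 : MvPolynomial (Fin 5) k) ^ c * (-(X 0 ^ 3)) ^ (6 - c) * (Nat.choose 6 c : MvPolynomial (Fin 5) k) *
        F₂ ^ 6) (c * 154 + (6 - c) * 126 + 0 + 6 * 462) := by
    have hchoose : IsWeightedHomogeneous (![42, 77, 231, 66, 154] : Fin 5 → ℕ)
        (Nat.choose 6 c : MvPolynomial (Fin 5) k) 0 := by
      rw [← map_natCast (C : k →+* MvPolynomial (Fin 5) k)]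
      exact isWeightedHomogeneous_C _ _
    have h := (((hA.pow c).mul (hB.pow (6 - c))).mul hchoose).mul (hF.pow 6)
    simpa only [smul_eq_mul] using h
  have hw := hhom hcoeff
  refine ⟨c, by rw [Finset.mem_range] at hc; omega, ?_⟩
  rw [hw]
  rw [Finset.mem_range] at hc
  omega

end Weights

/-! ## §3 The class of `x²⁰y⁶z⁶Φ⁶` is a singleton -/

/-- `42t₀+77t₁+231t₂+66t₃+154t₄ = 72 + 4c`, `c ≤ 6` forces `c = 3`, `t = (2,0,0,0,0)`. [folklore] -/
theorem arith_t (t0 t1 t2 t3 t4 c : ℕ) (hc : c ≤ 6) (h : 42 * t0 + 77 * t1 + 231 * t2 + 66 * t3 + 154 * t4 = 72 + 4 * c) :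
    t0 = 2 ∧ t1 = 0 ∧ t2 = 0 ∧ t3 = 0 ∧ t4 = 0 := by
  have b0 : t0 ≤ 2 := by omega
  have b1 : t1 ≤ 1 := by omega
  have b2 : t2 = 0 := by omega
  have b3 : t3 ≤ 1 := by omega
  have b4 : t4 = 0 := by omega
  subst b2 b4
  interval_cases t0 <;> interval_cases t1 <;> interval_cases t3 <;> omega

/-- An exponent of weight `3528 + 28c` (`c ≤ 6`) congruent to `x²⁰y⁶z⁶Φ⁶` modulo `7` equals it. [folklore] -/
theorem eq_gamma0_of_weight (a0 a1 a2 a3 a4 c : ℕ) (hc : c ≤ 6)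
    (hw : 42 * a0 + 77 * a1 + 231 * a2 + 66 * a3 + 154 * a4 = 3528 + 28 * c)
    (h0 : a0 % 7 = 6) (h1 : a1 % 7 = 6) (h2 : a2 % 7 = 6) (h3 : a3 % 7 = 0) (h4 : a4 % 7 = 6) :
    a0 = 20 ∧ a1 = 6 ∧ a2 = 6 ∧ a3 = 0 ∧ a4 = 6 := by
  have d0 := Nat.div_add_mod a0 7
  have d1 := Nat.div_add_mod a1 7
  have d2 := Nat.div_add_mod a2 7
  have d3 := Nat.div_add_mod a3 7
  have d4 := Nat.div_add_mod a4 7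
  rw [h0] at d0; rw [h1] at d1; rw [h2] at d2; rw [h3] at d3; rw [h4] at d4
  generalize a0 / 7 = t0 at d0
  generalize a1 / 7 = t1 at d1
  generalize a2 / 7 = t2 at d2
  generalize a3 / 7 = t3 at d3
  generalize a4 / 7 = t4 at d4
  clear h0 h1 h2 h3 h4
  subst d0 d1 d2 d3 d4
  obtain ⟨e0, e1, e2, e3, e4⟩ := arith_t t0 t1 t2 t3 t4 c hc (by omega)
  subst e0 e1 e2 e3 e4
  norm_num

/-! ## §4 The coefficient `1200` of `x²⁰y⁶z⁶Φ⁶`, by peeling -/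

set_option maxHeartbeats 4000000 in
/-- First peeling (`F₂ = G₃ + w⁷`): the `w`-free part of `(F₁F₂)⁶` is `(F₁G₃)⁶`. [folklore] -/
theorem peel_w {R : Type*} [CommRing R] (x y z w P : R) :
    ((P - y ^ 2 - x ^ 3) * (z ^ 2 + P ^ 3 + x ^ 11 + w ^ 7)) ^ 6 =
      ((P - y ^ 2 - x ^ 3) * (z ^ 2 + (P ^ 3 + x ^ 11))) ^ 6 +
        w ^ 7 * ((P - y ^ 2 - x ^ 3) ^ 6 *
          (6 * (z ^ 2 + P ^ 3 + x ^ 11) ^ 5 + 15 * (z ^ 2 + P ^ 3 + x ^ 11) ^ 4 * w ^ 7 +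
            20 * (z ^ 2 + P ^ 3 + x ^ 11) ^ 3 * w ^ 14 + 15 * (z ^ 2 + P ^ 3 + x ^ 11) ^ 2 * w ^ 21 +
            6 * (z ^ 2 + P ^ 3 + x ^ 11) * w ^ 28 + w ^ 35)) := by
  ring

set_option maxHeartbeats 4000000 in
/-- Second peeling (`G₃ = z² + H`, `H = Φ³ + x¹¹`), by `z`-degree. [folklore] -/
theorem peel_z {R : Type*} [CommRing R] (x y z P : R) :
    ((P - y ^ 2 - x ^ 3) * (z ^ 2 + (P ^ 3 + x ^ 11))) ^ 6 =
      z ^ 8 * ((P - y ^ 2 - x ^ 3) ^ 6 * (15 * (P ^ 3 + x ^ 11) ^ 2 + 6 * z ^ 2 * (P ^ 3 + x ^ 11) + z ^ 4)) +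
      20 * (z ^ 6 * ((P - y ^ 2 - x ^ 3) ^ 6 * (P ^ 3 + x ^ 11) ^ 3)) +
      15 * (z ^ 4 * ((P - y ^ 2 - x ^ 3) ^ 6 * (P ^ 3 + x ^ 11) ^ 4)) +
      6 * (z ^ 2 * ((P - y ^ 2 - x ^ 3) ^ 6 * (P ^ 3 + x ^ 11) ^ 5)) +
      z ^ 0 * ((P - y ^ 2 - x ^ 3) ^ 6 * (P ^ 3 + x ^ 11) ^ 6) := by
  ring

/-- Third peeling (`F₁ = A − y²`, `A = Φ − x³`), by `y`-degree. [folklore] -/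
theorem peel_y {R : Type*} [CommRing R] (x y P : R) :
    (P - y ^ 2 - x ^ 3) ^ 6 * (P ^ 3 + x ^ 11) ^ 3 =
      y ^ 8 * ((P ^ 3 + x ^ 11) ^ 3 * (15 * (P - x ^ 3) ^ 2 - 6 * y ^ 2 * (P - x ^ 3) + y ^ 4)) +
      (-20) * (y ^ 6 * ((P - x ^ 3) ^ 3 * (P ^ 3 + x ^ 11) ^ 3)) +
      15 * (y ^ 4 * ((P - x ^ 3) ^ 4 * (P ^ 3 + x ^ 11) ^ 3)) +
      (-6) * (y ^ 2 * ((P - x ^ 3) ^ 5 * (P ^ 3 + x ^ 11) ^ 3)) +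
      y ^ 0 * ((P - x ^ 3) ^ 6 * (P ^ 3 + x ^ 11) ^ 3) := by
  ring

/-- Last expansion: `(Φ−x³)³(Φ³+x¹¹)³` with its `x²⁰Φ⁶`-term (coefficient `−3`) isolated. [folklore] -/
theorem expand_xP {R : Type*} [CommRing R] (x P : R) :
    (P - x ^ 3) ^ 3 * (P ^ 3 + x ^ 11) ^ 3 =
      (-3) * (x ^ 20 * P ^ 6) +
      x ^ 21 * (3 * x * P ^ 6 - 9 * x ^ 4 * P ^ 5 + 9 * x ^ 7 * P ^ 4 - 3 * x ^ 10 * P ^ 3 + x ^ 12 * P ^ 3 -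
        3 * x ^ 15 * P ^ 2 + 3 * x ^ 18 * P - x ^ 21) +
      P ^ 7 * (P ^ 5 - 3 * x ^ 3 * P ^ 4 + 3 * x ^ 6 * P ^ 3 - x ^ 9 * P ^ 2 + 3 * x ^ 11 * P ^ 2 - 9 * x ^ 14 * P +
        9 * x ^ 17) := by
  ring

section Coeff

variable {k : Type} [Field k]

/-- Monomials of `k[X₀,…,X₄]` from exponent vectors. [folklore] -/
theorem monomial_five (a b c d e : ℕ) :
    (monomial (Finsupp.equivFunOnFinite.symm ![a, b, c, d, e]) (1 : k) : MvPolynomial (Fin 5) k) =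
      X 0 ^ a * X 1 ^ b * X 2 ^ c * X 3 ^ d * X 4 ^ e := by
  rw [monomial_eq, C_1, one_mul, Finsupp.prod_fintype _ _ (fun i => pow_zero _)]
  simp only [Fin.prod_univ_five, Finsupp.coe_equivFunOnFinite_symm, Matrix.cons_val_zero, Matrix.cons_val_one,
    Matrix.cons_val]

/-- `coeff_{x²⁰Φ⁶} ((Φ−x³)³(Φ³+x¹¹)³) = −3`. [folklore] -/
theorem coeff_step_xP :
    coeff (Finsupp.equivFunOnFinite.symm ![20, 0, 0, 0, 6])
      ((X 4 - X 0 ^ 3) ^ 3 * (X 4 ^ 3 + X 0 ^ 11) ^ 3 : MvPolynomial (Fin 5) k) = -3 := by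
  rw [expand_xP, coeff_add, coeff_add, coeff_X_pow_mul_eq_zero _ 0 21 (by simp), coeff_X_pow_mul_eq_zero _ 4 7 (by simp),
    add_zero, add_zero]
  have hm : (X 0 ^ 20 * X 4 ^ 6 : MvPolynomial (Fin 5) k) = monomial (Finsupp.equivFunOnFinite.symm ![20, 0, 0, 0, 6]) 1 := by
    rw [monomial_five]; simp
  rw [hm, show (-3 : MvPolynomial (Fin 5) k) = C (-3) by rw [map_neg, map_ofNat], coeff_C_mul, coeff_monomial, if_pos rfl,
    mul_one]

/-- `coeff_{x²⁰y⁶Φ⁶} (F₁⁶ H³) = 60`, `H = Φ³ + x¹¹` (third peeling: only the `y⁶`-term survives). [folklore] -/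
theorem coeff_step_y :
    coeff (Finsupp.equivFunOnFinite.symm ![20, 6, 0, 0, 6])
      ((X 4 - X 1 ^ 2 - X 0 ^ 3) ^ 6 * (X 4 ^ 3 + X 0 ^ 11) ^ 3 : MvPolynomial (Fin 5) k) = 60 := by
  have h10 : (1 : Fin 5) ≠ 0 := by decide
  have h14 : (1 : Fin 5) ≠ 4 := by decide
  have hA : (1 : Fin 5) ∉ (X 4 - X 0 ^ 3 : MvPolynomial (Fin 5) k).vars :=
    notMem_vars_sub (notMem_vars_X h14) (notMem_vars_pow (notMem_vars_X h10) 3)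
  have hH : (1 : Fin 5) ∉ (X 4 ^ 3 + X 0 ^ 11 : MvPolynomial (Fin 5) k).vars :=
    notMem_vars_add (notMem_vars_pow (notMem_vars_X h14) 3) (notMem_vars_pow (notMem_vars_X h10) 11)
  have hfree : ∀ i j : ℕ, (1 : Fin 5) ∉ ((X 4 - X 0 ^ 3) ^ i * (X 4 ^ 3 + X 0 ^ 11) ^ j : MvPolynomial (Fin 5) k).vars :=
    fun i j => notMem_vars_mul (notMem_vars_pow hA i) (notMem_vars_pow hH j)
  rw [peel_y, coeff_add, coeff_add, coeff_add, coeff_add, coeff_X_pow_mul_eq_zero _ 1 8 (by simp)]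
  rw [show (-20 : MvPolynomial (Fin 5) k) = C (-20) by rw [map_neg, map_ofNat],
    show (15 : MvPolynomial (Fin 5) k) = C 15 from (map_ofNat C 15).symm,
    show (-6 : MvPolynomial (Fin 5) k) = C (-6) by rw [map_neg, map_ofNat], coeff_C_mul, coeff_C_mul, coeff_C_mul]
  rw [coeff_X_pow_mul_of_notMem_vars _ 1 6 _ (hfree 3 3), coeff_X_pow_mul_of_notMem_vars _ 1 4 _ (hfree 4 3),
    coeff_X_pow_mul_of_notMem_vars _ 1 2 _ (hfree 5 3), coeff_X_pow_mul_of_notMem_vars _ 1 0 _ (hfree 6 3)]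
  simp only [Finsupp.coe_equivFunOnFinite_symm, Matrix.cons_val_one, Matrix.cons_val_zero]
  norm_num
  have hsub : (Finsupp.equivFunOnFinite.symm ![20, 6, 0, 0, 6] : Fin 5 →₀ ℕ) - Finsupp.single 1 6 =
      Finsupp.equivFunOnFinite.symm ![20, 0, 0, 0, 6] := by
    ext i
    fin_cases i <;> simp
  rw [hsub, coeff_step_xP]
  norm_num

/-- `coeff_{x²⁰y⁶z⁶Φ⁶} ((F₁G₃)⁶) = 1200`, `G₃ = z² + Φ³ + x¹¹` (second peeling: only the `z⁶`-term survives). [folklore] -/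
theorem coeff_step_z :
    coeff (Finsupp.equivFunOnFinite.symm ![20, 6, 6, 0, 6])
      (((X 4 - X 1 ^ 2 - X 0 ^ 3) * (X 2 ^ 2 + (X 4 ^ 3 + X 0 ^ 11))) ^ 6 : MvPolynomial (Fin 5) k) = 1200 := by
  have h20 : (2 : Fin 5) ≠ 0 := by decide
  have h21 : (2 : Fin 5) ≠ 1 := by decide
  have h24 : (2 : Fin 5) ≠ 4 := by decide
  have hF : (2 : Fin 5) ∉ (X 4 - X 1 ^ 2 - X 0 ^ 3 : MvPolynomial (Fin 5) k).vars :=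
    notMem_vars_sub (notMem_vars_sub (notMem_vars_X h24) (notMem_vars_pow (notMem_vars_X h21) 2))
      (notMem_vars_pow (notMem_vars_X h20) 3)
  have hH : (2 : Fin 5) ∉ (X 4 ^ 3 + X 0 ^ 11 : MvPolynomial (Fin 5) k).vars :=
    notMem_vars_add (notMem_vars_pow (notMem_vars_X h24) 3) (notMem_vars_pow (notMem_vars_X h20) 11)
  have hfree : ∀ j : ℕ, (2 : Fin 5) ∉ ((X 4 - X 1 ^ 2 - X 0 ^ 3) ^ 6 * (X 4 ^ 3 + X 0 ^ 11) ^ j : MvPolynomial (Fin 5) k).vars :=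
    fun j => notMem_vars_mul (notMem_vars_pow hF 6) (notMem_vars_pow hH j)
  rw [peel_z, coeff_add, coeff_add, coeff_add, coeff_add, coeff_X_pow_mul_eq_zero _ 2 8 (by simp)]
  rw [show (20 : MvPolynomial (Fin 5) k) = C 20 from (map_ofNat C 20).symm,
    show (15 : MvPolynomial (Fin 5) k) = C 15 from (map_ofNat C 15).symm,
    show (6 : MvPolynomial (Fin 5) k) = C 6 from (map_ofNat C 6).symm, coeff_C_mul, coeff_C_mul, coeff_C_mul]
  rw [coeff_X_pow_mul_of_notMem_vars _ 2 6 _ (hfree 3), coeff_X_pow_mul_of_notMem_vars _ 2 4 _ (hfree 4),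
    coeff_X_pow_mul_of_notMem_vars _ 2 2 _ (hfree 5), coeff_X_pow_mul_of_notMem_vars _ 2 0 _ (hfree 6)]
  simp only [Finsupp.coe_equivFunOnFinite_symm, Matrix.cons_val]
  norm_num
  have hsub : (Finsupp.equivFunOnFinite.symm ![20, 6, 6, 0, 6] : Fin 5 →₀ ℕ) - Finsupp.single 2 6 =
      Finsupp.equivFunOnFinite.symm ![20, 6, 0, 0, 6] := by
    ext i
    fin_cases i <;> simp
  rw [hsub, coeff_step_y]
  norm_num

/-- **`coeff_{x²⁰y⁶z⁶Φ⁶} ((F₁F₂)⁶) = 1200`** (`≡ 3 mod 7`). [folklore] -/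
theorem coeff_gamma0 (F₁ F₂ : MvPolynomial (Fin 5) k)
    (hF₁ : F₁ = X 4 - X 1 ^ 2 - X 0 ^ 3) (hF₂ : F₂ = X 2 ^ 2 + X 4 ^ 3 + X 0 ^ 11 + X 3 ^ 7) :
    coeff (Finsupp.equivFunOnFinite.symm ![20, 6, 6, 0, 6]) ((F₁ * F₂) ^ 6) = 1200 := by
  rw [hF₁, hF₂, peel_w, coeff_add, coeff_X_pow_mul_eq_zero _ 3 7 (by simp), add_zero, coeff_step_z]

end Coeff

/-! ## §5 Fedder's test at the points with `b_x ≠ 0`, characteristic `7` -/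

section Fedder

variable {k : Type} [Field k] [CharP k 7]

/-- **Fedder's test for `T₁₁⁺` at points with `b_x ≠ 0`** (`p = 7`): `((F₁F₂) ⊗ K)⁶ ∉ ((Xᵢ − bᵢ)⁷)`. Witness
`x²⁰y⁶z⁶Φ⁶`. [cite: Fedder1983, Prop. 1.7 and Prop. 2.1] -/
theorem t11Plus_fedder_x (F₁ F₂ : MvPolynomial (Fin 5) k)
    (hF₁ : F₁ = X 4 - X 1 ^ 2 - X 0 ^ 3) (hF₂ : F₂ = X 2 ^ 2 + X 4 ^ 3 + X 0 ^ 11 + X 3 ^ 7)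
    {K : Type} [Field K] [Algebra k K] (b : Fin 5 → K) (hb : b 0 ≠ 0) :
    (MvPolynomial.map (algebraMap k K) (F₁ * F₂)) ^ (7 - 1) ∉
      Ideal.span (Set.range fun i : Fin 5 => (MvPolynomial.X i - MvPolynomial.C (b i)) ^ 7) := by
  haveI : Fact (Nat.Prime 7) := ⟨by norm_num⟩
  refine fedder_of_singleton_support 7 (F₁ * F₂) (Finsupp.equivFunOnFinite.symm ![20, 6, 6, 0, 6]) ?_ ?_ b ?_
  · rw [show 7 - 1 = 6 from rfl, coeff_gamma0 F₁ F₂ hF₁ hF₂]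
    intro h
    have h' : ((1200 : ℕ) : k) = 0 := by exact_mod_cast h
    rw [CharP.cast_eq_zero_iff k 7] at h'
    omega
  · intro γ hγ hmod
    rw [show 7 - 1 = 6 from rfl] at hγ
    obtain ⟨c, hc, hw⟩ := weight_of_mem_support F₁ F₂ hF₁ hF₂ γ (mem_support_iff.mp hγ)
    rw [weight_five] at hw
    obtain ⟨e0, e1, e2, e3, e4⟩ := eq_gamma0_of_weight _ _ _ _ _ c hc hw (by simpa using hmod 0) (by simpa using hmod 1)
      (by simpa using hmod 2) (by simpa using hmod 3) (by simpa using hmod 4)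
    refine Finsupp.ext fun i => ?_
    rw [Finsupp.coe_equivFunOnFinite_symm]
    fin_cases i
    · exact e0
    · exact e1
    · exact e2
    · exact e3
    · exact e4
  · intro i hi
    simp only [Finsupp.coe_equivFunOnFinite_symm] at hi
    fin_cases i <;> norm_num at hi
    exact hb

end Fedder

end Summit.ResolutionOfSingularities.ResolutionOfSingularities.Theorems.FInjectiveMacaulayfication.T11PlusFedderData

end
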